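/-
Copyright: cell `langlands-arthur-audit` (papers/Langlands/langlands-arthur-audit), unit `pub-arthur-carver` (gen 7).
Staged for the tree under `Literature/NumberTheory/Automorphic/Mok2015/` (LEAN-IN-TREE rule 2026-08-18);
companion of `Mok2015/DependencyDag.lean` (tree, p175998 / p177863 / p177999 / p179439) — imports it and certifies,
leaf by leaf, the CONVERSE ("only if") half of the conditional reading recorded in `Nodes.main_conditional_form`:
in the dependency DAG AS TYPED there, which of the 29 leaves are load-bearing for which main theorem.
Generated by the cell script `pub-arthur-carver-g7/gen_support2.py mok` from the tree module (declaration order,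
edge constants, bundles); every generated table is re-certified by the kernel (`decide`), none is trusted.
Sister file of `Arthur2013/LeafSupport.lean` (p179578), same method.
-/
import Literature.NumberTheory.Automorphic.Mok2015.DependencyDag
import Literature.NumberTheory.Automorphic.LeafSupportKit

/-!
# Mok (2015) — leaf support of the kernel dependency DAG (countermodel certificates)

**Source reproduced.** C. P. Mok, *Endoscopic classification of representations of quasi-split unitary
groups*, Mem. AMS 235 (2015) no. 1108 = arXiv:1206.0882v5 [cite: Mok2012] — nothing beyond what
`Mok2015/DependencyDag.lean` already transcribes (the logical structure "section X consumes inputs Y, Z" of the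
memoir, first-hand from the held TeX, with the 2024–2026 supplies recorded from Atobe–Gan–Ichino–Kaletha–
Mínguez–Shin arXiv:2410.13504v3 [cite: AGIKMS2024]).  This file adds NO edge, NO node and NO leaf; it reads the
18 edge constants of that module and proves facts about them.

**What this file is.**  No mathematics of automorphic forms is formalised.  `DependencyDag.lean` proves the "if"
direction of the cell's conditional reading: Mok's nine main theorems (Thms 2.4.2, 2.4.10, 2.5.1, 2.5.2, 2.5.4,
3.2.1, 3.4.3, 5.1.2, 5.2.1) at every rank follow from the section edges, the supply edges and EXACTLY the 29
leaves (`Nodes.main_of_leaves`: 19 published, 8 preprint (2026), 2 unwritten), and `Nodes.main_conditional_form`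
phrases the outcome as "conditional exactly on the two unwritten weighted fundamental lemmas".  This file
settles the "only if" half for the DAG AS TYPED, by 29 kernel-checked countermodels:

* `LeafSupport.leaf_essential` — for each of the 29 leaves `l` there are `Nodes` satisfying EVERY edge-hypothesis
  bundle of the module (`SectionEdges`, `SupplyEdges` — packaged as `LeafSupport.Systems`) and every OTHER leaf,
  in which `l` fails and NONE of the six GLOBAL main theorems (Thms 2.4.2, 2.4.10, 2.5.2, 2.5.4, 5.1.2, 5.2.1)
  holds at ANY rank; hence (`not_derivable_without`) no leaf can be dropped from `main_of_leaves` AS TYPED, and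
  `unwritten_leaves_each_essential` displays the two unwritten leaves (`WFL_general` = AGIKMS (WFL-1)
  [AGIKMS2024 l.986-988], `WFL_nonstandard` = (WFL-2) [l.988-990]) separately.
* `LeafSupport.leaf_essential_local` — for every leaf EXCEPT `CharGLN` the same countermodel refutes also the
  three LOCAL main theorems (Thms 2.5.1, 3.2.1, 3.4.3) at every rank.  The one exception is a finding about the
  transcription, not a defect of it: the leaf `CharGLN` (ML28: character formulas for GL_N — Tadić 1995 and
  [A1, §7.5] — used in Mok's §9/Appendix [Mok l.9939-10036]) is a premise of the single edge `E_Ch9` (§9 +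
  Appendix: local theorems ⟹ global theorems), so AT FIXED
  RANK WITH THE INDUCTION HYPOTHESIS GRANTED the local theorems are derived without it (bit set in the least
  model `cm .CharGLN`); across ranks they are not, since `IH N` demands `All` — hence the global theorems —
  at lower ranks.  Every other published leaf, all eight 2026 preprint leaves and both unwritten leaves are
  load-bearing for all nine main theorems.
* `LeafSupport.necessary` — the same 29 countermodels give the NECESSITY half of the support of every one of the
  54 atoms (fields of `Nodes`): leaf `l` is needed for atom `a` whenever bit `a.idx` of the numeral `cm l` is
  clear (`necessary l a (by decide)`).  Least-model supports so obtained (script-computed, each entry certifiable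
  by that lemma; SUFFICIENCY of the listed set at fixed rank given the induction hypothesis holds in the
  propositional abstraction but is NOT asserted by this file):
  - main theorems: `T242` (29) = all 29; `T2410` (29) = all 29; `T251` (28) = all but {CharGLN}; `T252` (29) = all
    29; `T254` (29) = all 29; `T321` (28) = all but {CharGLN}; `T343` (28) = all but {CharGLN}; `T512` (29) = all
    29; `T521` (29) = all 29.
  - intermediate nodes (rank-indexed ones at fixed rank, IH granted): `TWFL` (3) = {W4_Thm38, WFL_general,
    WFL_nonstandard}; `StabOrdU` (4) = {FL, WFL_split, STF_Arthur, WFL_general}; `StabTw` (6) = {FL, W4_Thm38,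
    TwistedTF, MW_Stab, WFL_general, WFL_nonstandard}; `P311` (1) = {MW_Stab_I411}; `A12` (1) = {AGIKMS_191}; `P353`
    (2) = {Shahidi, AGIKMS_181}; `L255` (2) = {AGIKMS_181, AGIKMS_D21}; `A13` (26) = all but {BanSplit, CharGLN,
    KMSW_AppA}; `P825` (3) = {AubertSS, BanSplit, KMSW_AppA}; `TECR_R` (20) = all but {LocalTF, AubertSS, BanSplit,
    A11_twisted, CharGLN, AGIKMS_1105, AGIKMS_D21, CK26, KMSW_AppA}; `Ch3` (9) = {LLC_GLN, Transfer, FL,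
    MW_Stab_I411, InvariantTF, Shahidi, A1_args, AGIKMS_181, AGIKMS_191}; `Ch4` (17) = {LLC_GLN, SpecGLN, Transfer,
    FL, WFL_split, W4_Thm38, STF_Arthur, TwistedTF, MW_Stab, MW_Stab_I411, InvariantTF, Shahidi, A1_args,
    AGIKMS_181, AGIKMS_191, WFL_general, WFL_nonstandard}; `Ch5` (17) = {LLC_GLN, SpecGLN, Transfer, FL, WFL_split,
    W4_Thm38, STF_Arthur, TwistedTF, MW_Stab, MW_Stab_I411, InvariantTF, Shahidi, A1_args, AGIKMS_181, AGIKMS_191,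
    WFL_general, WFL_nonstandard}; `Ch6` (18) = {LLC_GLN, SpecGLN, Transfer, FL, WFL_split, W4_Thm38, STF_Arthur,
    TwistedTF, MW_Stab, MW_Stab_I411, InvariantTF, Shahidi, ArchInputs_published, A1_args, AGIKMS_181, AGIKMS_191,
    WFL_general, WFL_nonstandard}; `Glob` (18) = {LLC_GLN, SpecGLN, Transfer, FL, WFL_split, W4_Thm38, STF_Arthur,
    TwistedTF, MW_Stab, MW_Stab_I411, InvariantTF, Shahidi, ArchInputs_published, A1_args, AGIKMS_181, AGIKMS_191,
    WFL_general, WFL_nonstandard}; `LocalTemp` (23) = all but {AubertSS, BanSplit, CharGLN, AGIKMS_1105, CK26,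
    KMSW_AppA}.

**Method (reflective, all bookkeeping)** — identical to `Arthur2013/LeafSupport.lean`, with the generic Boolean
clause kit (`bit`, `allP`/`allB`, `noneP`/`noneB`, `okE`, `sound`) imported from `LeafSupportKit.lean`.  An `Atom` is one of the
54 fields of `Nodes`; a valuation is a numeral `v : Nat` (atom `a` true iff bit `a.idx` is set) and `mkN v` is
the structure it determines (rank-indexed fields constant in the rank).  Each of the 18 edge constants is a Horn
clause "premise atoms ⟹ conclusion atom(s)" once the rank binder and the induction-hypothesis premise `ν.IH N`
are dropped — legitimate for constant valuations, and conservative: a model found WITH `IH` granted is a model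
of the edge as typed.  `systems_of_check` proves ONCE, symbolically in `v`, that the Boolean clause check
`checkAll v` implies both bundles for `mkN v` (one term per bundle field, elaborated against the edge constant
itself, so a mis-transcribed clause would not typecheck); each countermodel is then `decide` on a numeral.  The
numerals `cm l` are the least models (forward chaining from the other 28 leaves), computed by the cell script
and certified here, not trusted.
SCOPE CAVEATS. (i) "Essential" is relative to the transcription: the DAG records which inputs each section of
[Mok] states it consumes; a finer or corrected transcription is judged by re-running the script, which
regenerates this file from the module.  (ii) At fixed rank with `IH N` granted — the strongest position for
dropping a leaf; across ranks supports can only grow (see `CharGLN` above).  (iii) The joint system with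
Kaletha–Mínguez–Shin–White (`KMSW2014/WithMok.lean`: Mok's leaf `KMSW_AppA` discharged to KMSW's Appendix A)
is not treated here; `KMSW2014/LeafSupport.lean` treats KMSW's own DAG.

Axioms: every theorem of this file is closed or uses only `propext` (via `simp`/`decide`); `Classical.choice`
is not needed, and no compiled evaluation (`Lean.ofReduceBool`) is used — every certificate is kernel `decide`.
-/

namespace Literature.NumberTheory.Automorphic.Mok2015

namespace LeafSupport

open Literature.NumberTheory.Automorphic.LeafSupportKit

/-! ## 1. Atoms: one constant per field of `Nodes` (54) -/

/-- The 54 atoms of the kernel DAG = the fields of `Nodes` (54), in declaration order; rank-indexed fields are read at one fixed rank. [folklore] (bookkeeping) -/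
inductive Atom where
  | LLC_GLN | SpecGLN | Transfer | FL | WFL_split | W4_Thm38 | STF_Arthur | TwistedTF | MW_Stab | MW_Stab_I411
  | LocalTF | InvariantTF | Shahidi | AubertSS | BanSplit | ArchInputs_published | A11_twisted | CharGLN | A1_args
  | AGIKMS_181 | AGIKMS_191 | AGIKMS_1105 | AGIKMS_D21 | AGIKMS_AppE | KM26 | CK26 | KMSW_AppA | WFL_general
  | WFL_nonstandard | TWFL | StabOrdU | StabTw | P311 | A12 | P353 | L255 | A13 | P825 | TECR_R | T242 | T2410 | T251
  | T252 | T254 | T321 | T343 | T512 | T521 | Ch3 | Ch4 | Ch5 | Ch6 | Glob | LocalTemp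

/-- Bit position of an atom in a valuation numeral (= its declaration index, 0–53). [folklore] (bookkeeping) -/
def Atom.idx : Atom → Nat
  | .LLC_GLN => 0 | .SpecGLN => 1 | .Transfer => 2 | .FL => 3 | .WFL_split => 4 | .W4_Thm38 => 5 | .STF_Arthur => 6
  | .TwistedTF => 7 | .MW_Stab => 8 | .MW_Stab_I411 => 9 | .LocalTF => 10 | .InvariantTF => 11 | .Shahidi => 12
  | .AubertSS => 13 | .BanSplit => 14 | .ArchInputs_published => 15 | .A11_twisted => 16 | .CharGLN => 17
  | .A1_args => 18 | .AGIKMS_181 => 19 | .AGIKMS_191 => 20 | .AGIKMS_1105 => 21 | .AGIKMS_D21 => 22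
  | .AGIKMS_AppE => 23 | .KM26 => 24 | .CK26 => 25 | .KMSW_AppA => 26 | .WFL_general => 27 | .WFL_nonstandard => 28
  | .TWFL => 29 | .StabOrdU => 30 | .StabTw => 31 | .P311 => 32 | .A12 => 33 | .P353 => 34 | .L255 => 35 | .A13 => 36
  | .P825 => 37 | .TECR_R => 38 | .T242 => 39 | .T2410 => 40 | .T251 => 41 | .T252 => 42 | .T254 => 43 | .T321 => 44
  | .T343 => 45 | .T512 => 46 | .T521 => 47 | .Ch3 => 48 | .Ch4 => 49 | .Ch5 => 50 | .Ch6 => 51 | .Glob => 52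
  | .LocalTemp => 53

/-- Interpretation of an atom in given `Nodes` at rank `N` (rank-free fields ignore `N`). [folklore] (bookkeeping) -/
def Atom.prop (ν : Nodes) (N : Nat) : Atom → Prop
  | .LLC_GLN => ν.LLC_GLN | .SpecGLN => ν.SpecGLN | .Transfer => ν.Transfer | .FL => ν.FL | .WFL_split => ν.WFL_split
  | .W4_Thm38 => ν.W4_Thm38 | .STF_Arthur => ν.STF_Arthur | .TwistedTF => ν.TwistedTF | .MW_Stab => ν.MW_Stab
  | .MW_Stab_I411 => ν.MW_Stab_I411 | .LocalTF => ν.LocalTF | .InvariantTF => ν.InvariantTF | .Shahidi => ν.Shahidi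
  | .AubertSS => ν.AubertSS | .BanSplit => ν.BanSplit | .ArchInputs_published => ν.ArchInputs_published
  | .A11_twisted => ν.A11_twisted | .CharGLN => ν.CharGLN | .A1_args => ν.A1_args | .AGIKMS_181 => ν.AGIKMS_181
  | .AGIKMS_191 => ν.AGIKMS_191 | .AGIKMS_1105 => ν.AGIKMS_1105 | .AGIKMS_D21 => ν.AGIKMS_D21
  | .AGIKMS_AppE => ν.AGIKMS_AppE | .KM26 => ν.KM26 | .CK26 => ν.CK26 | .KMSW_AppA => ν.KMSW_AppA
  | .WFL_general => ν.WFL_general | .WFL_nonstandard => ν.WFL_nonstandard | .TWFL => ν.TWFL | .StabOrdU => ν.StabOrdU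
  | .StabTw => ν.StabTw | .P311 => ν.P311 | .A12 => ν.A12 | .P353 => ν.P353 | .L255 => ν.L255 | .A13 => ν.A13 N
  | .P825 => ν.P825 | .TECR_R => ν.TECR_R N | .T242 => ν.T242 N | .T2410 => ν.T2410 N | .T251 => ν.T251 N
  | .T252 => ν.T252 N | .T254 => ν.T254 N | .T321 => ν.T321 N | .T343 => ν.T343 N | .T512 => ν.T512 N
  | .T521 => ν.T521 N | .Ch3 => ν.Ch3 N | .Ch4 => ν.Ch4 N | .Ch5 => ν.Ch5 N | .Ch6 => ν.Ch6 N | .Glob => ν.Glob N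
  | .LocalTemp => ν.LocalTemp N

/-! ## 2. Boolean valuations -/

/-- The `Nodes` determined by the valuation numeral `v` (rank-indexed fields constant in the rank). [folklore] (bookkeeping) -/
def mkN (v : Nat) : Nodes where
  LLC_GLN := bit Atom.idx v .LLC_GLN
  SpecGLN := bit Atom.idx v .SpecGLN
  Transfer := bit Atom.idx v .Transfer
  FL := bit Atom.idx v .FL
  WFL_split := bit Atom.idx v .WFL_split
  W4_Thm38 := bit Atom.idx v .W4_Thm38
  STF_Arthur := bit Atom.idx v .STF_Arthur
  TwistedTF := bit Atom.idx v .TwistedTF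
  MW_Stab := bit Atom.idx v .MW_Stab
  MW_Stab_I411 := bit Atom.idx v .MW_Stab_I411
  LocalTF := bit Atom.idx v .LocalTF
  InvariantTF := bit Atom.idx v .InvariantTF
  Shahidi := bit Atom.idx v .Shahidi
  AubertSS := bit Atom.idx v .AubertSS
  BanSplit := bit Atom.idx v .BanSplit
  ArchInputs_published := bit Atom.idx v .ArchInputs_published
  A11_twisted := bit Atom.idx v .A11_twisted
  CharGLN := bit Atom.idx v .CharGLN
  A1_args := bit Atom.idx v .A1_args
  AGIKMS_181 := bit Atom.idx v .AGIKMS_181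
  AGIKMS_191 := bit Atom.idx v .AGIKMS_191
  AGIKMS_1105 := bit Atom.idx v .AGIKMS_1105
  AGIKMS_D21 := bit Atom.idx v .AGIKMS_D21
  AGIKMS_AppE := bit Atom.idx v .AGIKMS_AppE
  KM26 := bit Atom.idx v .KM26
  CK26 := bit Atom.idx v .CK26
  KMSW_AppA := bit Atom.idx v .KMSW_AppA
  WFL_general := bit Atom.idx v .WFL_general
  WFL_nonstandard := bit Atom.idx v .WFL_nonstandard
  TWFL := bit Atom.idx v .TWFL
  StabOrdU := bit Atom.idx v .StabOrdU
  StabTw := bit Atom.idx v .StabTw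
  P311 := bit Atom.idx v .P311
  A12 := bit Atom.idx v .A12
  P353 := bit Atom.idx v .P353
  L255 := bit Atom.idx v .L255
  A13 := fun _ => bit Atom.idx v .A13
  P825 := bit Atom.idx v .P825
  TECR_R := fun _ => bit Atom.idx v .TECR_R
  T242 := fun _ => bit Atom.idx v .T242
  T2410 := fun _ => bit Atom.idx v .T2410
  T251 := fun _ => bit Atom.idx v .T251
  T252 := fun _ => bit Atom.idx v .T252
  T254 := fun _ => bit Atom.idx v .T254
  T321 := fun _ => bit Atom.idx v .T321
  T343 := fun _ => bit Atom.idx v .T343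
  T512 := fun _ => bit Atom.idx v .T512
  T521 := fun _ => bit Atom.idx v .T521
  Ch3 := fun _ => bit Atom.idx v .Ch3
  Ch4 := fun _ => bit Atom.idx v .Ch4
  Ch5 := fun _ => bit Atom.idx v .Ch5
  Ch6 := fun _ => bit Atom.idx v .Ch6
  Glob := fun _ => bit Atom.idx v .Glob
  LocalTemp := fun _ => bit Atom.idx v .LocalTemp

/-- Under the valuation structures every atom reads as its bit. [folklore] (bookkeeping) -/
theorem prop_mk (v N : Nat) : ∀ a : Atom, a.prop (mkN v) N ↔ bit Atom.idx v a := by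
  intro a; cases a <;> exact Iff.rfl

/-! ## 3. The edge system: every edge-hypothesis bundle of the module(s) -/

/-- ALL edge hypotheses at once: the bundles `SectionEdges`, `SupplyEdges` — 2 bundles, 18 fields, 18 distinct edge
constants; a superset of the hypotheses of each landed composition theorem of the module(s). [folklore] (bookkeeping: packaging of the transcribed edges) -/
structure Systems (ν : Nodes) : Prop where
  sect : ν.SectionEdges
  supply : ν.SupplyEdges

/-- The 18 clauses (premise atoms ⟹ conclusion atoms) read off the edge constants, as Boolean checks on a valuation numeral;
`IH N` and the rank binder are dropped (a valuation is constant in the rank, and `IH 0` holds). [folklore] (bookkeeping) -/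
structure Oks (v : Nat) : Prop where
  sect_ch3 : okE Atom.idx v [.LLC_GLN, .Transfer, .FL, .P311, .P353, .A12, .InvariantTF, .A1_args] [.Ch3] = true
  sect_ch4 : okE Atom.idx v [.StabOrdU, .StabTw, .SpecGLN, .InvariantTF, .TwistedTF, .Ch3, .A1_args] [.Ch4] = true
  sect_ch5 : okE Atom.idx v [.Ch3, .Ch4, .A12, .P353, .A1_args] [.Ch5] = true
  sect_ch6 : okE Atom.idx v [.Ch3, .Ch4, .Ch5, .ArchInputs_published, .A1_args] [.Ch6] = true
  sect_ch7a : okE Atom.idx v [.Ch3, .Ch4, .Ch5, .Ch6, .InvariantTF, .ArchInputs_published, .A1_args] [.Glob] = true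
  sect_ch7 : okE Atom.idx v [.Ch3, .Ch5, .Ch6, .Glob, .LocalTF, .InvariantTF, .L255, .TECR_R, .A11_twisted, .Transfer, .FL, .StabTw, .A1_args] [.LocalTemp] = true
  sect_ch8 : okE Atom.idx v [.LocalTemp, .AubertSS, .A13, .P825, .A12, .Ch5, .Ch6, .FL, .A1_args] [.T251, .T321, .T343] = true
  sect_ch9 : okE Atom.idx v [.T251, .T321, .T343, .Ch4, .Ch5, .Ch6, .Glob, .SpecGLN, .CharGLN, .InvariantTF, .A1_args] [.T242, .T2410, .T252, .T254, .T512, .T521] = true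
  supply_twfl : okE Atom.idx v [.W4_Thm38, .WFL_general, .WFL_nonstandard] [.TWFL] = true
  supply_stabOrd : okE Atom.idx v [.FL, .WFL_split, .WFL_general, .STF_Arthur] [.StabOrdU] = true
  supply_stabTw : okE Atom.idx v [.TWFL, .WFL_nonstandard, .FL, .TwistedTF, .MW_Stab] [.StabTw] = true
  supply_p311 : okE Atom.idx v [.MW_Stab_I411] [.P311] = true
  supply_a12 : okE Atom.idx v [.AGIKMS_191] [.A12] = true
  supply_p353 : okE Atom.idx v [.Shahidi, .AGIKMS_181] [.P353] = true
  supply_l255 : okE Atom.idx v [.AGIKMS_D21, .AGIKMS_181] [.L255] = true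
  supply_a13 : okE Atom.idx v [.AGIKMS_1105, .CK26, .AubertSS, .LocalTemp] [.A13] = true
  supply_p825 : okE Atom.idx v [.BanSplit, .KMSW_AppA, .AubertSS] [.P825] = true
  supply_tecr : okE Atom.idx v [.AGIKMS_AppE, .ArchInputs_published, .KM26, .Ch6, .Glob] [.TECR_R] = true

/-- Conjunction of the 18 clause checks. [folklore] (bookkeeping) -/
def checkAll (v : Nat) : Bool :=
  okE Atom.idx v [.LLC_GLN, .Transfer, .FL, .P311, .P353, .A12, .InvariantTF, .A1_args] [.Ch3] &&
  (okE Atom.idx v [.StabOrdU, .StabTw, .SpecGLN, .InvariantTF, .TwistedTF, .Ch3, .A1_args] [.Ch4] &&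
  (okE Atom.idx v [.Ch3, .Ch4, .A12, .P353, .A1_args] [.Ch5] &&
  (okE Atom.idx v [.Ch3, .Ch4, .Ch5, .ArchInputs_published, .A1_args] [.Ch6] &&
  (okE Atom.idx v [.Ch3, .Ch4, .Ch5, .Ch6, .InvariantTF, .ArchInputs_published, .A1_args] [.Glob] &&
  (okE Atom.idx v [.Ch3, .Ch5, .Ch6, .Glob, .LocalTF, .InvariantTF, .L255, .TECR_R, .A11_twisted, .Transfer, .FL, .StabTw, .A1_args] [.LocalTemp] &&
  (okE Atom.idx v [.LocalTemp, .AubertSS, .A13, .P825, .A12, .Ch5, .Ch6, .FL, .A1_args] [.T251, .T321, .T343] &&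
  (okE Atom.idx v [.T251, .T321, .T343, .Ch4, .Ch5, .Ch6, .Glob, .SpecGLN, .CharGLN, .InvariantTF, .A1_args] [.T242, .T2410, .T252, .T254, .T512, .T521] &&
  (okE Atom.idx v [.W4_Thm38, .WFL_general, .WFL_nonstandard] [.TWFL] &&
  (okE Atom.idx v [.FL, .WFL_split, .WFL_general, .STF_Arthur] [.StabOrdU] &&
  (okE Atom.idx v [.TWFL, .WFL_nonstandard, .FL, .TwistedTF, .MW_Stab] [.StabTw] &&
  (okE Atom.idx v [.MW_Stab_I411] [.P311] &&
  (okE Atom.idx v [.AGIKMS_191] [.A12] &&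
  (okE Atom.idx v [.Shahidi, .AGIKMS_181] [.P353] &&
  (okE Atom.idx v [.AGIKMS_D21, .AGIKMS_181] [.L255] &&
  (okE Atom.idx v [.AGIKMS_1105, .CK26, .AubertSS, .LocalTemp] [.A13] &&
  (okE Atom.idx v [.BanSplit, .KMSW_AppA, .AubertSS] [.P825] &&
  (okE Atom.idx v [.AGIKMS_AppE, .ArchInputs_published, .KM26, .Ch6, .Glob] [.TECR_R])))))))))))))))))

/-- SOUNDNESS OF THE CLAUSE READING: if the clauses hold in the valuation `v`, every edge hypothesis holds for the valuation
structures (at every rank; the induction-hypothesis premise is not used). [folklore] (bookkeeping proved here) -/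
theorem systems_of_check (v : Nat) (h : checkAll v = true) : Systems (mkN v) :=
  have o : Oks v := by
    simp only [checkAll, Bool.and_eq_true] at h
    obtain ⟨h0, h1, h2, h3, h4, h5, h6, h7, h8, h9, h10, h11, h12, h13, h14, h15, h16, h17⟩ := h
    exact ⟨h0, h1, h2, h3, h4, h5, h6, h7, h8, h9, h10, h11, h12, h13, h14, h15, h16, h17⟩
  { sect :=
      { ch3 := fun _ _ h1 h2 h3 h4 h5 h6 h7 h8 => (sound o.sect_ch3 ⟨h1, h2, h3, h4, h5, h6, h7, h8, trivial⟩).1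
        ch4 := fun _ _ h1 h2 h3 h4 h5 h6 h7 => (sound o.sect_ch4 ⟨h1, h2, h3, h4, h5, h6, h7, trivial⟩).1
        ch5 := fun _ _ h1 h2 h3 h4 h5 => (sound o.sect_ch5 ⟨h1, h2, h3, h4, h5, trivial⟩).1
        ch6 := fun _ _ h1 h2 h3 h4 h5 => (sound o.sect_ch6 ⟨h1, h2, h3, h4, h5, trivial⟩).1
        ch7a := fun _ _ h1 h2 h3 h4 h5 h6 h7 => (sound o.sect_ch7a ⟨h1, h2, h3, h4, h5, h6, h7, trivial⟩).1
        ch7 := fun _ _ h1 h2 h3 h4 h5 h6 h7 h8 h9 h10 h11 h12 h13 => (sound o.sect_ch7 ⟨h1, h2, h3, h4, h5, h6, h7, h8, h9, h10, h11, h12, h13, trivial⟩).1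
        ch8 := fun _ _ h1 h2 h3 h4 h5 h6 h7 h8 h9 => have s := sound o.sect_ch8 ⟨h1, h2, h3, h4, h5, h6, h7, h8, h9, trivial⟩; ⟨s.1, s.2.1, s.2.2.1⟩
        ch9 := fun _ _ g1 h2 h3 h4 h5 h6 h7 h8 h9 => have s := sound o.sect_ch9 ⟨g1.1, g1.2.1, g1.2.2, h2, h3, h4, h5, h6, h7, h8, h9, trivial⟩; ⟨s.1, s.2.1, s.2.2.1, s.2.2.2.1, s.2.2.2.2.1, s.2.2.2.2.2.1⟩ }
    supply :=
      { twfl := fun h1 h2 h3 => (sound o.supply_twfl ⟨h1, h2, h3, trivial⟩).1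
        stabOrd := fun h1 h2 h3 h4 => (sound o.supply_stabOrd ⟨h1, h2, h3, h4, trivial⟩).1
        stabTw := fun h1 h2 h3 h4 h5 => (sound o.supply_stabTw ⟨h1, h2, h3, h4, h5, trivial⟩).1
        p311 := fun h1 => (sound o.supply_p311 ⟨h1, trivial⟩).1
        a12 := fun h1 => (sound o.supply_a12 ⟨h1, trivial⟩).1
        p353 := fun h1 h2 => (sound o.supply_p353 ⟨h1, h2, trivial⟩).1
        l255 := fun h1 h2 => (sound o.supply_l255 ⟨h1, h2, trivial⟩).1
        a13 := fun h1 h2 h3 _ _ h4 => (sound o.supply_a13 ⟨h1, h2, h3, h4, trivial⟩).1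
        p825 := fun h1 h2 h3 => (sound o.supply_p825 ⟨h1, h2, h3, trivial⟩).1
        tecr := fun h1 h2 h3 _ _ h4 h5 => (sound o.supply_tecr ⟨h1, h2, h3, h4, h5, trivial⟩).1 } }

/-! ## 4. The 29 leaves and the main theorems -/

/-- The 29 leaves = the fields of `PublishedLeaves` (19), `PreprintLeaves2026` (8), `UnwrittenLeaves` (2), in that order. [folklore] (bookkeeping: leaf inventory of the module) -/
inductive Leaf where
  | LLC_GLN | SpecGLN | Transfer | FL | WFL_split | W4_Thm38 | STF_Arthur | TwistedTF | MW_Stab | MW_Stab_I411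
  | LocalTF | InvariantTF | Shahidi | AubertSS | BanSplit | ArchInputs_published | A11_twisted | CharGLN | A1_args
  | AGIKMS_181 | AGIKMS_191 | AGIKMS_1105 | AGIKMS_D21 | AGIKMS_AppE | KM26 | CK26 | KMSW_AppA | WFL_general
  | WFL_nonstandard
  deriving DecidableEq

/-- The atom of a leaf. [folklore] (bookkeeping) -/
def Leaf.toAtom : Leaf → Atom
  | .LLC_GLN => .LLC_GLN | .SpecGLN => .SpecGLN | .Transfer => .Transfer | .FL => .FL | .WFL_split => .WFL_split
  | .W4_Thm38 => .W4_Thm38 | .STF_Arthur => .STF_Arthur | .TwistedTF => .TwistedTF | .MW_Stab => .MW_Stab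
  | .MW_Stab_I411 => .MW_Stab_I411 | .LocalTF => .LocalTF | .InvariantTF => .InvariantTF | .Shahidi => .Shahidi
  | .AubertSS => .AubertSS | .BanSplit => .BanSplit | .ArchInputs_published => .ArchInputs_published
  | .A11_twisted => .A11_twisted | .CharGLN => .CharGLN | .A1_args => .A1_args | .AGIKMS_181 => .AGIKMS_181
  | .AGIKMS_191 => .AGIKMS_191 | .AGIKMS_1105 => .AGIKMS_1105 | .AGIKMS_D21 => .AGIKMS_D21
  | .AGIKMS_AppE => .AGIKMS_AppE | .KM26 => .KM26 | .CK26 => .CK26 | .KMSW_AppA => .KMSW_AppA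
  | .WFL_general => .WFL_general | .WFL_nonstandard => .WFL_nonstandard

/-- The proposition a leaf names in given `Nodes`: its atom, read at any rank (leaves are rank-free). [folklore] (bookkeeping) -/
def _root_.Literature.NumberTheory.Automorphic.Mok2015.Nodes.leaf (ν : Nodes) (l : Leaf) : Prop := l.toAtom.prop ν 0

/-- The leaf bundles say exactly "every leaf holds". [folklore] (bookkeeping proved here) -/
theorem leaves_iff (ν : Nodes) :
    (∀ l : Leaf, ν.leaf l) ↔ ν.PublishedLeaves ∧ ν.PreprintLeaves2026 ∧ ν.UnwrittenLeaves := by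
  constructor
  · intro h
    exact ⟨⟨h .LLC_GLN, h .SpecGLN, h .Transfer, h .FL, h .WFL_split, h .W4_Thm38, h .STF_Arthur, h .TwistedTF, h .MW_Stab, h .MW_Stab_I411, h .LocalTF, h .InvariantTF, h .Shahidi, h .AubertSS, h .BanSplit, h .ArchInputs_published, h .A11_twisted, h .CharGLN, h .A1_args⟩, ⟨h .AGIKMS_181, h .AGIKMS_191, h .AGIKMS_1105, h .AGIKMS_D21, h .AGIKMS_AppE, h .KM26, h .CK26, h .KMSW_AppA⟩, ⟨h .WFL_general, h .WFL_nonstandard⟩⟩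
  · intro ⟨P, Q, U⟩ l
    cases l
    · exact P.llc
    · exact P.spec
    · exact P.transfer
    · exact P.fl
    · exact P.wfl_split
    · exact P.w4
    · exact P.stf
    · exact P.ttf
    · exact P.mwStab
    · exact P.mwI411
    · exact P.ltf
    · exact P.itf
    · exact P.shahidi
    · exact P.aubert
    · exact P.ban
    · exact P.arch
    · exact P.a11tw
    · exact P.charGLN
    · exact P.a1args
    · exact Q.agikms181
    · exact Q.agikms191
    · exact Q.agikms1105
    · exact Q.agikmsD21
    · exact Q.agikmsAppE
    · exact Q.km26
    · exact Q.ck26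
    · exact Q.kmswAppA
    · exact U.wfl_general
    · exact U.wfl_nonstandard

/-- Conjunction over all 29 leaves of a Boolean test (a fold written out, so that unpacking it needs no list lemmas). [folklore] (bookkeeping) -/
def Leaf.mokAllB (p : Leaf → Bool) : Bool :=
  p .LLC_GLN &&
  (p .SpecGLN &&
  (p .Transfer &&
  (p .FL &&
  (p .WFL_split &&
  (p .W4_Thm38 &&
  (p .STF_Arthur &&
  (p .TwistedTF &&
  (p .MW_Stab &&
  (p .MW_Stab_I411 &&
  (p .LocalTF &&
  (p .InvariantTF &&
  (p .Shahidi &&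
  (p .AubertSS &&
  (p .BanSplit &&
  (p .ArchInputs_published &&
  (p .A11_twisted &&
  (p .CharGLN &&
  (p .A1_args &&
  (p .AGIKMS_181 &&
  (p .AGIKMS_191 &&
  (p .AGIKMS_1105 &&
  (p .AGIKMS_D21 &&
  (p .AGIKMS_AppE &&
  (p .KM26 &&
  (p .CK26 &&
  (p .KMSW_AppA &&
  (p .WFL_general &&
  (p .WFL_nonstandard))))))))))))))))))))))))))))

/-- `Leaf.mokAllB p` says `p` holds at every leaf. [folklore] (bookkeeping) -/
theorem Leaf.mokAllB_iff (p : Leaf → Bool) : Leaf.mokAllB p = true ↔ ∀ l, p l = true := by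
  constructor
  · intro h l
    simp only [Leaf.mokAllB, Bool.and_eq_true] at h
    obtain ⟨h0, h1, h2, h3, h4, h5, h6, h7, h8, h9, h10, h11, h12, h13, h14, h15, h16, h17, h18, h19, h20, h21, h22, h23, h24, h25, h26, h27, h28⟩ := h
    cases l <;> assumption
  · intro h; simp [Leaf.mokAllB, h]

/-- Boolean test: every leaf other than `l` holds in the valuation `v`. [folklore] (bookkeeping) -/
def mokOthersB (v : Nat) (l : Leaf) : Bool := Leaf.mokAllB fun l' => decide (l' = l) || v.testBit l'.toAtom.idx

/-- Soundness of `mokOthersB`. [folklore] (bookkeeping) -/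
theorem others_of_mokOthersB (v : Nat) (l : Leaf) (h : mokOthersB v l = true) : ∀ l', l' ≠ l → (mkN v).leaf l' := by
  intro l' hne
  have h' := (Leaf.mokAllB_iff _).1 h l'
  simp [hne] at h'
  exact (prop_mk v 0 (Leaf.toAtom l')).2 h'

/-- NONE of the main theorems `T242`, `T2410`, `T252`, `T254`, `T512`, `T521` holds at rank `N` — the main theorems whose least-model support is EVERY leaf; the remaining ones (`T251`, `T321`, `T343`) fail in all countermodels but those of `CharGLN` (query them with `necessary`). [folklore] (bookkeeping) -/
def _root_.Literature.NumberTheory.Automorphic.Mok2015.Nodes.NoGlobalMain (ν : Nodes) (N : Nat) : Prop :=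
  ¬ ν.T242 N ∧ ¬ ν.T2410 N ∧ ¬ ν.T252 N ∧ ¬ ν.T254 N ∧ ¬ ν.T512 N ∧ ¬ ν.T521 N

/-- `NoGlobalMain` refutes `All`. [folklore] (bookkeeping) -/
theorem not_all_of_noGlobalMain {ν : Nodes} {N : Nat} (h : ν.NoGlobalMain N) : ¬ ν.All N :=
  fun a => h.1 a.2.1

/-- The main-theorem atoms refuted in every countermodel. [folklore] (bookkeeping) -/
def globalMains : List Atom := [.T242, .T2410, .T252, .T254, .T512, .T521]

/-- Reading `NoGlobalMain` off the valuation. [folklore] (bookkeeping) -/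
theorem noGlobalMain_mk (v N : Nat) (h : noneB Atom.idx v globalMains = true) : (mkN v).NoGlobalMain N :=
  have p := noneP_of_noneB Atom.idx v globalMains h
  ⟨p.1, p.2.1, p.2.2.1, p.2.2.2.1, p.2.2.2.2.1, p.2.2.2.2.2.1⟩

/-! ## 5. The 29 countermodels: least model of the edge system over all leaves but one, IH granted -/

/-- For each leaf `l`, the valuation numeral of the LEAST set of atoms containing every other leaf and closed under all
edge clauses (forward chaining by the cell script; certified below by `decide`, not trusted). [folklore] (bookkeeping) -/
def cm : Leaf → Nat
  | .LLC_GLN => 206158430206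
  | .SpecGLN => 281681135140861
  | .Transfer => 206158430203
  | .FL => 202937204727
  | .WFL_split => 281680061399023
  | .W4_Thm38 => 281678450786271
  | .STF_Arthur => 281680061398975
  | .TwistedTF => 281678987657087
  | .MW_Stab => 281678987656959
  | .MW_Stab_I411 => 201863462399
  | .LocalTF => 8726205314366463
  | .InvariantTF => 206158428159
  | .Shahidi => 188978556927
  | .AubertSS => 17733267130146815
  | .BanSplit => 17733335849615359
  | .ArchInputs_published => 1970530995372031
  | .A11_twisted => 8726205314301951
  | .CharGLN => 17788448869842943
  | .A1_args => 206158168063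
  | .AGIKMS_181 => 154618298367
  | .AGIKMS_191 => 197567447039
  | .AGIKMS_1105 => 17733404567011327
  | .AGIKMS_D21 => 8726170950434815
  | .AGIKMS_AppE => 8725930428071935
  | .KM26 => 8725930419683327
  | .CK26 => 17733404535554047
  | .KMSW_AppA => 17733335782522879
  | .WFL_general => 281677242826751
  | .WFL_nonstandard => 281678182350847

/-- KERNEL CERTIFICATE per leaf: the countermodel satisfies every edge bundle and every other leaf, while the removed leaf
and the main theorems of `NoGlobalMain` fail at every rank. [folklore] (bookkeeping proved here: necessity of each leaf in the DAG as typed) -/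
theorem countermodel (l : Leaf) :
    Systems (mkN (cm l)) ∧ (∀ l', l' ≠ l → (mkN (cm l)).leaf l') ∧
    ¬ (mkN (cm l)).leaf l ∧ ∀ N, (mkN (cm l)).NoGlobalMain N := by
  cases l <;> exact ⟨systems_of_check _ (by decide), others_of_mokOthersB _ _ (by decide),
    fun h => absurd ((prop_mk _ 0 (Leaf.toAtom _)).1 h) (by decide), fun N => noGlobalMain_mk _ N (by decide)⟩

/-! ## 5b. The remaining main theorems: `T251`, `T321`, `T343` -/

/-- NONE of the three LOCAL main theorems (Thms 2.5.1, 3.2.1, 3.4.3) holds at rank `N`. [folklore] (bookkeeping) -/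
def _root_.Literature.NumberTheory.Automorphic.Mok2015.Nodes.NoLocalMain (ν : Nodes) (N : Nat) : Prop :=
  ¬ ν.T251 N ∧ ¬ ν.T321 N ∧ ¬ ν.T343 N

/-- `NoLocalMain` refutes `LocalAll`. [folklore] (bookkeeping) -/
theorem not_localAll_of {ν : Nodes} {N : Nat} (h : ν.NoLocalMain N) : ¬ ν.LocalAll N :=
  fun a => h.1 a.1

/-- The atoms of the three LOCAL main theorems (Thms 2.5.1, 3.2.1, 3.4.3). [folklore] (bookkeeping) -/
def localMains : List Atom := [.T251, .T321, .T343]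

/-- Reading `NoLocalMain` off the valuation. [folklore] (bookkeeping) -/
theorem noLocalMain_mk (v N : Nat) (h : noneB Atom.idx v localMains = true) : (mkN v).NoLocalMain N :=
  have p := noneP_of_noneB Atom.idx v localMains h
  ⟨p.1, p.2.1, p.2.2.1⟩

/-- The 1 leaf/leaves whose removal does NOT (at fixed rank, IH granted) destroy `T251`, `T321`, `T343`: `CharGLN` —
in the least model without such a leaf those atoms are still derived (bit set in `cm`), i.e. the leaf enters only the derivations of `T242`, `T2410`, `T252`, `T254`, `T512`, `T521`. [folklore] (bookkeeping) -/
def Leaf.onlyGlobal : Leaf → Bool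
  | .CharGLN => true | _ => false

/-- KERNEL CERTIFICATE, second tier: for every leaf NOT flagged by `Leaf.onlyGlobal`, its countermodel also refutes `T251`, `T321`, `T343`
at every rank. [folklore] (bookkeeping proved here) -/
theorem local_mains_fail (l : Leaf) (h : l.onlyGlobal = false) : ∀ N, (mkN (cm l)).NoLocalMain N := by
  cases l <;> first | exact absurd h (by decide) | exact fun N => noLocalMain_mk _ N (by decide)

/-- LEAF ESSENTIALITY, second tier: every leaf not flagged by `Leaf.onlyGlobal` is load-bearing for the three LOCAL main theorems (Thms 2.5.1, 3.2.1, 3.4.3) as well —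
a model of every edge bundle and every other leaf in which the leaf and ALL main theorems fail at every rank. [folklore] (bookkeeping proved here) -/
theorem leaf_essential_local (l : Leaf) (h : l.onlyGlobal = false) :
    ∃ (ν : Nodes), Systems ν ∧ (∀ l', l' ≠ l → ν.leaf l') ∧ ¬ ν.leaf l ∧ ∀ N, ν.NoGlobalMain N ∧ ν.NoLocalMain N :=
  ⟨_, (countermodel l).1, (countermodel l).2.1, (countermodel l).2.2.1,
    fun N => ⟨(countermodel l).2.2.2 N, local_mains_fail l h N⟩⟩

/-- No unflagged leaf is redundant for `LocalAll` either. [folklore] (bookkeeping proved here) -/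
theorem not_derivable_local_without (l : Leaf) (h : l.onlyGlobal = false) :
    ¬ (∀ (ν : Nodes), Systems ν → (∀ l', l' ≠ l → ν.leaf l') → ∃ N, ν.LocalAll N) := by
  intro H
  obtain ⟨N, hN⟩ := H _ (countermodel l).1 (countermodel l).2.1
  exact not_localAll_of (local_mains_fail l h N) hN

/-! ## 6. Consequences -/

/-- LEAF ESSENTIALITY: for every leaf there is a model of every edge bundle and every OTHER leaf in which the leaf fails and
the main theorems of `NoGlobalMain` fail at every rank — no such leaf can be dropped from the landed composition theorems AS TYPED.
A statement about the cell's TRANSCRIPTION of the dependency structure, not about the mathematics. [folklore] (bookkeeping proved here) -/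
theorem leaf_essential (l : Leaf) :
    ∃ (ν : Nodes), Systems ν ∧ (∀ l', l' ≠ l → ν.leaf l') ∧ ¬ ν.leaf l ∧ ∀ N, ν.NoGlobalMain N :=
  ⟨_, countermodel l⟩

/-- No leaf is redundant for `All`: the edge system and the other leaves do not give even one rank at which `All` holds. [folklore] (bookkeeping proved here) -/
theorem not_derivable_without (l : Leaf) :
    ¬ (∀ (ν : Nodes), Systems ν → (∀ l', l' ≠ l → ν.leaf l') → ∃ N, ν.All N) := by
  intro H
  obtain ⟨N, hN⟩ := H _ (countermodel l).1 (countermodel l).2.1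
  exact not_all_of_noGlobalMain ((countermodel l).2.2.2 N) hN

/-- The two STILL-UNWRITTEN weighted fundamental lemmas separately: granting every edge, every other leaf bundle and ONE of
them, the other is still needed — without it the main theorems of `NoGlobalMain` fail at every rank. [cite: AGIKMS2024, l.380-382 and l.986-990 (bookkeeping proved here)] -/
theorem unwritten_leaves_each_essential :
    (∃ (ν : Nodes), Systems ν ∧ ν.PublishedLeaves ∧ ν.PreprintLeaves2026 ∧ ν.WFL_nonstandard ∧ ¬ ν.WFL_general ∧ ∀ N, ν.NoGlobalMain N) ∧
    (∃ (ν : Nodes), Systems ν ∧ ν.PublishedLeaves ∧ ν.PreprintLeaves2026 ∧ ν.WFL_general ∧ ¬ ν.WFL_nonstandard ∧ ∀ N, ν.NoGlobalMain N) := by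
  constructor
  · have c := countermodel .WFL_general
    have h := c.2.1
    exact ⟨_, c.1, ⟨h .LLC_GLN (by decide), h .SpecGLN (by decide), h .Transfer (by decide), h .FL (by decide), h .WFL_split (by decide), h .W4_Thm38 (by decide), h .STF_Arthur (by decide), h .TwistedTF (by decide), h .MW_Stab (by decide), h .MW_Stab_I411 (by decide), h .LocalTF (by decide), h .InvariantTF (by decide), h .Shahidi (by decide), h .AubertSS (by decide), h .BanSplit (by decide), h .ArchInputs_published (by decide), h .A11_twisted (by decide), h .CharGLN (by decide), h .A1_args (by decide)⟩, ⟨h .AGIKMS_181 (by decide), h .AGIKMS_191 (by decide), h .AGIKMS_1105 (by decide), h .AGIKMS_D21 (by decide), h .AGIKMS_AppE (by decide), h .KM26 (by decide), h .CK26 (by decide), h .KMSW_AppA (by decide)⟩,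
      h .WFL_nonstandard (by decide), c.2.2.1, c.2.2.2⟩
  · have c := countermodel .WFL_nonstandard
    have h := c.2.1
    exact ⟨_, c.1, ⟨h .LLC_GLN (by decide), h .SpecGLN (by decide), h .Transfer (by decide), h .FL (by decide), h .WFL_split (by decide), h .W4_Thm38 (by decide), h .STF_Arthur (by decide), h .TwistedTF (by decide), h .MW_Stab (by decide), h .MW_Stab_I411 (by decide), h .LocalTF (by decide), h .InvariantTF (by decide), h .Shahidi (by decide), h .AubertSS (by decide), h .BanSplit (by decide), h .ArchInputs_published (by decide), h .A11_twisted (by decide), h .CharGLN (by decide), h .A1_args (by decide)⟩, ⟨h .AGIKMS_181 (by decide), h .AGIKMS_191 (by decide), h .AGIKMS_1105 (by decide), h .AGIKMS_D21 (by decide), h .AGIKMS_AppE (by decide), h .KM26 (by decide), h .CK26 (by decide), h .KMSW_AppA (by decide)⟩,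
      h .WFL_general (by decide), c.2.2.1, c.2.2.2⟩

/-! ## 7. Necessity for ANY node: reading the support table off the countermodels -/

/-- QUERY LEMMA.  If bit `a.idx` of `cm l` is clear, atom `a` fails at every rank in a model of all edges and all leaves but
`l`: leaf `l` is in the least-model support of `a`.  Usage: `necessary <leaf> <atom> (by decide)`; table in the module docstring. [folklore] (bookkeeping proved here) -/
theorem necessary (l : Leaf) (a : Atom) (h : (cm l).testBit a.idx = false) :
    Systems (mkN (cm l)) ∧ (∀ l', l' ≠ l → (mkN (cm l)).leaf l') ∧
      ∀ N, ¬ a.prop (mkN (cm l)) N :=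
  ⟨(countermodel l).1, (countermodel l).2.1, fun N hp => by
    have hb := (prop_mk _ N a).1 hp
    simp [bit, h] at hb⟩

end LeafSupport

end Literature.NumberTheory.Automorphic.Mok2015
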